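import Summits.CriticalPhenomena.SAWScalingLimit.Theorems.SAWTotalPositivityCriticalBubbleBoundJoinDefs
import Summits.CriticalPhenomena.SAWScalingLimit.Theorems.SAWTotalPositivityCriticalBubbleBoundLedgerBootstrap
import Summits.CriticalPhenomena.SAWScalingLimit.Theorems.CriticalBubbleBound.Negative.CriticalBubbleBoundProvedWindow

/-!
# The ledger of the JOIN-MASS programme (stubs `jterm_le_exp`, `join_ledger` of line
`docking-census-joining`, crux stmt-CriticalPhenomena-7117
`Summit.CriticalPhenomena.SAWScalingLimit.Theses.SAWTotalPositivity.CriticalBubbleBound`)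

The landed ledger bootstrap `Docking.stub_ledgerBootstrap` (the exponent ledger `θ - 1 = κ + π` as a
theorem about an arbitrary nonnegative sequence) is specialised to the data of the JOIN-MASS programme:
the shifted class sequence `t := jterm`, the rarity-side mass `U := Urar`, docking ENTROPY `κ = 3/2`
(so `κ - 1 = 1/2`), RARITY `π = 0` with polynomial factor `(i+1)^1`.  Its conclusion
`R'_i := blockMass jterm i ≤ C' 2^{s i}` then holds for every `s > 1 - (κ + π) = -1/2`
(the side condition `s ≥ -3/2` of the ledger is automatic).

* `jterm_le_exp` — the a-priori stretched-exponential input of the ledger for `jterm`, from the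
  Hammersley–Welsh bound `Negative.hw_term_upper_bound` (`c_n(0,e₀) x_cⁿ ≤ e^{κ√n}`) and
  `#lexRooted n ≤ #sawFun 2 n e₀ = c_n(0,e₀)`, `x_c ≤ 1`;
* `join_ledger` — the ledger at `(κ, π, b) = (3/2, 0, 1)`.
-/

noncomputable section

open Literature.Probability.LatticeModels
open Literature.Probability.RandomPlanarGeometry Literature.Probability.RandomPlanarGeometry.SAW
open scoped BigOperators
open Summit.CriticalPhenomena.SAWScalingLimit.Theorems.CriticalBubbleBound.Negative (e₀)
open Summit.CriticalPhenomena.SAWScalingLimit.Theorems.CriticalBubbleBound.Docking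

namespace Summit.CriticalPhenomena.SAWScalingLimit.Theorems.CriticalBubbleBound.Join

/-- **A-priori bound for the shifted class sequence** (registered stub `jterm_le_exp`):
`jterm n ≤ exp (K √n)` for some `K`.  For `n ≥ 17`,
`jterm n = #lexRooted (n-17) · x_c^{n-17+1} ≤ c_{n-17}(0,e₀) x_c^{n-17} · x_c ≤ e^{κ √(n-17)} ≤ e^{|κ| √n}`
(Hammersley–Welsh); for `n < 17`, `jterm n = 0`. [cite: BDGS2012, §1.5.1, eq. (1.25)] -/
theorem jterm_le_exp : ∃ K : ℝ, ∀ n : ℕ, jterm n ≤ Real.exp (K * Real.sqrt n) := by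
  obtain ⟨κ, hκ⟩ := Negative.hw_term_upper_bound
  refine ⟨|κ|, fun n => ?_⟩
  by_cases h : joinShift ≤ n
  · rw [jterm_of_le h, cterm]
    have hx := criticalFugacity_pos_lt_one'
    have hcard : ((lexRooted (n - joinShift)).card : ℝ) ≤ (Zd.countAt 2 (n - joinShift) e₀ : ℝ) := by
      rw [← Zd.card_sawFun]
      exact_mod_cast Finset.card_le_card (lexRooted_subset _)
    have hpow : 0 ≤ criticalFugacity ^ (n - joinShift) := pow_nonneg hx.1.le _
    calc ((lexRooted (n - joinShift)).card : ℝ) * criticalFugacity ^ (n - joinShift + 1)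
        = ((lexRooted (n - joinShift)).card : ℝ) * criticalFugacity ^ (n - joinShift)
            * criticalFugacity := by
          rw [pow_succ, mul_assoc]
      _ ≤ (Zd.countAt 2 (n - joinShift) e₀ : ℝ) * criticalFugacity ^ (n - joinShift) * 1 :=
          mul_le_mul (mul_le_mul_of_nonneg_right hcard hpow) hx.2.le hx.1.le
            (mul_nonneg (Nat.cast_nonneg _) hpow)
      _ ≤ Real.exp (κ * Real.sqrt ((n - joinShift : ℕ) : ℝ)) := by
          rw [mul_one]
          exact hκ e₀ _
      _ ≤ Real.exp (|κ| * Real.sqrt n) := by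
          apply Real.exp_le_exp.2
          calc κ * Real.sqrt ((n - joinShift : ℕ) : ℝ)
              ≤ |κ| * Real.sqrt ((n - joinShift : ℕ) : ℝ) :=
                mul_le_mul_of_nonneg_right (le_abs_self κ) (Real.sqrt_nonneg _)
            _ ≤ |κ| * Real.sqrt n := by
                apply mul_le_mul_of_nonneg_left _ (abs_nonneg κ)
                apply Real.sqrt_le_sqrt
                exact_mod_cast Nat.sub_le n joinShift
  · rw [jterm_of_lt (not_le.1 h)]
    exact (Real.exp_pos _).le

/-- **The ledger of the JOIN-MASS programme** (registered stub `join_ledger`): the landed ledger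
bootstrap `Docking.stub_ledgerBootstrap` at `(κ, π, b) = (3/2, 0, 1)` for `t := jterm`, `U := Urar`.
From docking entropy `c 2^{i/2} (R'_i)² ≤ D i` (`i ≥ i₀`), the injection `D i ≤ K₁ U i` and rarity
`U i ≤ C (i+1) R'_{i+1} + C 2^{-4i}` one gets `R'_i ≤ C' 2^{s i}` for every `s > -1/2`.
[cite: Hammond2015SAPJoining, §4] -/
theorem join_ledger : ∀ (D : ℕ → ℝ) (c K₁ C : ℝ) (i₀ : ℕ), 0 < c → 0 < K₁ → (∀ i : ℕ, i₀ ≤ i → c * (2 : ℝ) ^ ((1 / 2 : ℝ) * (i : ℝ)) * blockMass jterm i ^ 2 ≤ D i) → (∀ i : ℕ, D i ≤ K₁ * Urar i) → (∀ i : ℕ, Urar i ≤ C * ((i : ℝ) + 1) * blockMass jterm (i + 1) + C * (2 : ℝ) ^ (-(4 : ℝ) * (i : ℝ))) → ∀ s : ℝ, -(1 : ℝ) / 2 < s → ∃ C' : ℝ, ∀ i : ℕ, blockMass jterm i ≤ C' * (2 : ℝ) ^ (s * (i : ℝ)) := by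
  intro D c K₁ C i₀ hc hK₁ hDock hD hU s hs
  -- docking entropy in the ledger's shape: `(3/2 - 1) * i = (1/2) * i`
  have hDock' : ∀ i : ℕ, i₀ ≤ i →
      c * (2 : ℝ) ^ (((3 / 2 : ℝ) - 1) * (i : ℝ)) *
        (∑ n ∈ Finset.Ico (2 ^ i) (2 ^ (i + 1)), jterm n) ^ 2 ≤ D i := by
    intro i hi
    have h12 : ((3 / 2 : ℝ) - 1) = 1 / 2 := by norm_num
    rw [h12, ← blockMass_eq]
    exact hDock i hi
  -- rarity in the ledger's shape: `(i+1)^(1:ℝ) * 2^(-0 * i) = i + 1`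
  have hU' : ∀ i : ℕ, Urar i ≤ C * ((i : ℝ) + 1) ^ (1 : ℝ) * (2 : ℝ) ^ (-(0 : ℝ) * (i : ℝ)) *
      (∑ n ∈ Finset.Ico (2 ^ (i + 1)) (2 ^ (i + 1 + 1)), jterm n)
        + C * (2 : ℝ) ^ (-(4 : ℝ) * (i : ℝ)) := by
    intro i
    rw [Real.rpow_one, neg_zero, zero_mul, Real.rpow_zero, mul_one, ← blockMass_eq]
    exact hU i
  obtain ⟨C', hC'⟩ := stub_ledgerBootstrap (3 / 2) 0 (by norm_num) jterm D Urar jterm_nonneg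
    jterm_le_exp ⟨K₁, hK₁, hD⟩ ⟨c, hc, i₀, hDock'⟩ ⟨C, 1, hU'⟩ s (by linarith) (by linarith)
  exact ⟨C', fun i => by rw [blockMass_eq]; exact hC' i⟩

end Summit.CriticalPhenomena.SAWScalingLimit.Theorems.CriticalBubbleBound.Join

end
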